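import Mathlib
import Summits.Ventures.PercRepro2.Defs
import Summits.Ventures.PercRepro2.Harris
import Summits.Ventures.PercRepro2.Graph
import Summits.Ventures.PercRepro2.Events
import Summits.Ventures.PercRepro2.Induced
import Summits.Ventures.PercRepro2.CRFKG

/-!
# (CR) holds whenever the cluster law is log-supermodular
(blind cell PercRepro2, mine-a g39; MINE-A.md §94.0–§94.1, §94.9)

The candidate (CR) of MINE-A.md §93.9 — in the kernel the hypothesis `hcr` of
`CRForms.xorForm_nonneg_of_cr`:
`0 ≤ P(R)·P(Rᶜ ∩ U ∩ e) + P(R ∩ U)·P(R ∩ e) − P(R)·P(U)·P(e)` with `R = avoidAll ends s X`,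
`U = clusterInEvent ends s 𝓤`, `e = clusterInEvent ends s 𝓥` — depends on the configuration only
through the cluster `C_s`.  This file transports `CRFKG.cr_avoid` (every log-supermodular law on
the subset lattice satisfies (CR) for every avoidance conditioning) along the cluster map
`ω ↦ C_s(ω)`: **if the cluster law `S ↦ P(C_s = S)` is log-supermodular on the subsets of `V`,
then (CR) holds** (`cr_of_clusterLaw_lsm`).  The hypothesis is exactly what fails on a general
graph (MINE-A.md §94.1: the connectivity factor `Z(S) = P(G[S] connected)` is not
log-supermodular) and what holds on a forest (the root-subtree law is log-modular) — so this is the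
kernel form of the §94.0 corollary «(CR) on forests», modulo the identity for the forest cluster
law.  No definition; one seat.
-/

namespace Summit.Ventures.PercRepro2

namespace CRClusterLaw

open Finset

variable {V : Type*} {E : Type*} [Fintype V] [DecidableEq V] [Fintype E] [DecidableEq E]
  {K : Type*} [Field K] [LinearOrder K] [IsStrictOrderedRing K]

variable (ends : E → Sym2 V) (s : V)

omit [DecidableEq E] in
/-- The cluster of `s` as a `Finset`: its coercion is `cluster ends ω s`. -/
lemma coe_clusterFinset (ω : Config E) :
    ((univ.filter fun u => Conn ends ω s u : Finset V) : Set V) = cluster ends ω s := by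
  ext u; simp [cluster]

omit [DecidableEq E] in
/-- The cluster fibre `{C_s = S}` through the `Finset` cluster. -/
lemma clusterFinset_eq_iff (ω : Config E) (S : Finset V) :
    (univ.filter fun u => Conn ends ω s u : Finset V) = S ↔ cluster ends ω s = (S : Set V) := by
  rw [← coe_clusterFinset ends s ω]
  exact Finset.coe_inj.symm

omit [LinearOrder K] [IsStrictOrderedRing K] in
/-- **The cluster-law expansion**: the expectation of a function of the cluster of `s` is the sum
over the possible clusters `S` of `P(C_s = S) · f S`. -/
lemma expect_of_cluster (p : E → K) (f : Finset V → K) :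
    expect p (fun ω => f (univ.filter fun u => Conn ends ω s u)) =
      ∑ S : Finset V, prob p {ω | cluster ends ω s = (S : Set V)} * f S := by
  classical
  unfold expect
  rw [← sum_fiberwise univ (fun ω : Config E => (univ.filter fun u => Conn ends ω s u : Finset V))
    (fun ω => weight p ω * f (univ.filter fun u => Conn ends ω s u))]
  refine sum_congr rfl fun S _ => ?_
  rw [prob_eq_sum_filter, sum_mul]
  have hset : (univ.filter fun ω : Config E => (univ.filter fun u => Conn ends ω s u : Finset V) = S) =
      univ.filter fun ω : Config E => ω ∈ {ω | cluster ends ω s = (S : Set V)} := by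
    ext ω
    simp only [mem_filter, mem_univ, true_and, Set.mem_setOf_eq]
    exact clusterFinset_eq_iff ends s ω S
  rw [← hset]
  refine sum_congr rfl fun ω hω => ?_
  rw [mem_filter] at hω
  rw [hω.2]

omit [DecidableEq E] in
/-- The avoidance event is a cluster condition: `s ↮ X ↔ C_s ∩ X = ∅`. -/
lemma mem_avoidAll_iff (ω : Config E) (X : Finset V) :
    ω ∈ avoidAll ends s X ↔ (univ.filter fun u => Conn ends ω s u : Finset V) ∩ X = ∅ := by
  simp only [avoidAll, Set.mem_setOf_eq, Finset.eq_empty_iff_forall_notMem, mem_inter, mem_filter,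
    mem_univ, true_and, not_and]
  constructor
  · intro h x hx hxX; exact h x hxX hx
  · intro h x hxX hx; exact h x hx hxX

omit [DecidableEq E] [LinearOrder K] [IsStrictOrderedRing K] in
open scoped Classical in
/-- The indicator of a cluster event through the `Finset` cluster. -/
lemma indicator_clusterInEvent (𝓤 : Set (Set V)) (ω : Config E) :
    (clusterInEvent ends s 𝓤).indicator (1 : Config E → K) ω =
      if (((univ.filter fun u => Conn ends ω s u : Finset V) : Set V) ∈ 𝓤) then 1 else 0 := by
  rw [coe_clusterFinset]
  by_cases h : ω ∈ clusterInEvent ends s 𝓤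
  · rw [Set.indicator_of_mem h]; simp [mem_clusterInEvent] at h; simp [h]
  · rw [Set.indicator_of_notMem h]; simp [mem_clusterInEvent] at h; simp [h]

/-- **(CR) under a log-supermodular cluster law.** If `S ↦ P(C_s = S)` satisfies the FKG lattice
condition on the subsets of `V`, then for every finite `X`, and up-sets `𝓤, 𝓥` of vertex sets,
`0 ≤ P(R)·P(Rᶜ ∩ U ∩ e) + P(R ∩ U)·P(R ∩ e) − P(R)·P(U)·P(e)` with `R = {s ↮ X}`,
`U = {C_s ∈ 𝓤}`, `e = {C_s ∈ 𝓥}` — the hypothesis `hcr` of `CRForms.xorForm_nonneg_of_cr`. -/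
theorem cr_of_clusterLaw_lsm (p : E → K) (hp : IsProbVec p) (X : Finset V)
    {𝓤 𝓥 : Set (Set V)} (h𝓤 : IsUpperSet 𝓤) (h𝓥 : IsUpperSet 𝓥)
    (hlsm : ∀ S T : Finset V,
      prob p {ω | cluster ends ω s = (S : Set V)} * prob p {ω | cluster ends ω s = (T : Set V)} ≤
        prob p {ω | cluster ends ω s = ((S ∩ T : Finset V) : Set V)} *
          prob p {ω | cluster ends ω s = ((S ∪ T : Finset V) : Set V)}) :
    let Rv := avoidAll ends s X
    let U := clusterInEvent ends s 𝓤
    let e := clusterInEvent ends s 𝓥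
    0 ≤ prob p Rv * prob p (Rvᶜ ∩ U ∩ e) + prob p (Rv ∩ U) * prob p (Rv ∩ e) -
        prob p Rv * prob p U * prob p e := by
  intro Rv U e
  classical
  -- the cluster law and the two indicator functions on `Finset V`
  set w : Finset V → K := fun S => prob p {ω | cluster ends ω s = (S : Set V)} with hw
  set u : Finset V → K := fun S => if ((S : Set V) ∈ 𝓤) then 1 else 0 with hu
  set v : Finset V → K := fun S => if ((S : Set V) ∈ 𝓥) then 1 else 0 with hv
  have hw0 : ∀ S, 0 ≤ w S := fun S => prob_nonneg hp _
  have hu0 : ∀ S, 0 ≤ u S := fun S => by simp only [hu]; split_ifs <;> norm_num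
  have hu1 : ∀ S, u S ≤ 1 := fun S => by simp only [hu]; split_ifs <;> norm_num
  have hv0 : ∀ S, 0 ≤ v S := fun S => by simp only [hv]; split_ifs <;> norm_num
  have hv1 : ∀ S, v S ≤ 1 := fun S => by simp only [hv]; split_ifs <;> norm_num
  have humono : ∀ S T, S ⊆ T → u S ≤ u T := fun S T hST => by
    simp only [hu]
    by_cases hS : (S : Set V) ∈ 𝓤
    · have hT : (T : Set V) ∈ 𝓤 := h𝓤 (Finset.coe_subset.2 hST) hS
      simp [hS, hT]
    · simp [hS]; split_ifs <;> norm_num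
  have hvmono : ∀ S T, S ⊆ T → v S ≤ v T := fun S T hST => by
    simp only [hv]
    by_cases hS : (S : Set V) ∈ 𝓥
    · have hT : (T : Set V) ∈ 𝓥 := h𝓥 (Finset.coe_subset.2 hST) hS
      simp [hS, hT]
    · simp [hS]; split_ifs <;> norm_num
  -- the six probabilities as cluster-law sums
  have hexp : ∀ (A : Set (Config E)) (g : Finset V → K),
      (∀ ω, A.indicator (1 : Config E → K) ω = g (univ.filter fun u => Conn ends ω s u)) →
      prob p A = ∑ S : Finset V, w S * g S := by
    intro A g hg
    rw [prob_eq_expect_indicator]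
    have : (A.indicator (1 : Config E → K)) = fun ω => g (univ.filter fun u => Conn ends ω s u) :=
      funext hg
    rw [this, expect_of_cluster]
  have hR : prob p Rv = ∑ S, w S * (if S ∩ X = ∅ then 1 else 0) := by
    refine hexp _ _ fun ω => ?_
    by_cases h : ω ∈ Rv
    · rw [Set.indicator_of_mem h]; rw [mem_avoidAll_iff] at h; simp [h]
    · rw [Set.indicator_of_notMem h]; rw [mem_avoidAll_iff] at h; simp [h]
  have hU : prob p U = ∑ S, w S * u S := by
    refine hexp _ _ fun ω => ?_
    exact indicator_clusterInEvent ends s 𝓤 ω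
  have he : prob p e = ∑ S, w S * v S := by
    refine hexp _ _ fun ω => ?_
    exact indicator_clusterInEvent ends s 𝓥 ω
  have hind : ∀ (A B : Set (Config E)) (ω : Config E),
      (A ∩ B).indicator (1 : Config E → K) ω = A.indicator 1 ω * B.indicator 1 ω := by
    intro A B ω
    by_cases hA : ω ∈ A <;> by_cases hB : ω ∈ B <;> simp [hA, hB]
  have hRind : ∀ ω, Rv.indicator (1 : Config E → K) ω =
      if (univ.filter fun u => Conn ends ω s u : Finset V) ∩ X = ∅ then 1 else 0 := by
    intro ω
    by_cases h : ω ∈ Rv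
    · rw [Set.indicator_of_mem h]; rw [mem_avoidAll_iff] at h; simp [h]
    · rw [Set.indicator_of_notMem h]; rw [mem_avoidAll_iff] at h; simp [h]
  have hRcind : ∀ ω, Rvᶜ.indicator (1 : Config E → K) ω =
      if (univ.filter fun u => Conn ends ω s u : Finset V) ∩ X = ∅ then 0 else 1 := by
    intro ω
    by_cases h : ω ∈ Rv
    · rw [Set.indicator_of_notMem (Set.notMem_compl_iff.2 h)]; rw [mem_avoidAll_iff] at h; simp [h]
    · rw [Set.indicator_of_mem (Set.mem_compl h)]; rw [mem_avoidAll_iff] at h; simp [h]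
  have hRU : prob p (Rv ∩ U) = ∑ S, w S * ((if S ∩ X = ∅ then 1 else 0) * u S) := by
    refine hexp _ _ fun ω => ?_
    rw [hind, hRind, indicator_clusterInEvent]
  have hRe : prob p (Rv ∩ e) = ∑ S, w S * ((if S ∩ X = ∅ then 1 else 0) * v S) := by
    refine hexp _ _ fun ω => ?_
    rw [hind, hRind, indicator_clusterInEvent]
  have hRcUe : prob p (Rvᶜ ∩ U ∩ e) =
      ∑ S, w S * ((if S ∩ X = ∅ then 0 else 1) * (u S * v S)) := by
    refine hexp _ _ fun ω => ?_
    rw [hind, hind, hRcind, indicator_clusterInEvent, indicator_clusterInEvent, mul_assoc]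
  have htot : ∑ S, w S = 1 := by
    have := hexp Set.univ (fun _ => 1) (fun ω => by simp)
    rw [prob_univ] at this
    simpa using this.symm
  -- the FKG-lattice theorem for the cluster law
  have key := CRFKG.cr_avoid (X := X) hw0 hlsm hu0 hu1 humono hv0 hv1 hvmono
  -- translate its filtered sums into indicator sums
  have e1 : (∑ S ∈ univ.filter (fun S => S ∩ X = ∅), w S) =
      ∑ S, w S * (if S ∩ X = ∅ then 1 else 0) := by
    rw [sum_filter]; refine sum_congr rfl fun S _ => ?_; split_ifs <;> simp
  have e2 : (∑ S ∈ univ.filter (fun S => S ∩ X = ∅), w S * u S) =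
      ∑ S, w S * ((if S ∩ X = ∅ then 1 else 0) * u S) := by
    rw [sum_filter]; refine sum_congr rfl fun S _ => ?_; split_ifs <;> simp
  have e3 : (∑ S ∈ univ.filter (fun S => S ∩ X = ∅), w S * v S) =
      ∑ S, w S * ((if S ∩ X = ∅ then 1 else 0) * v S) := by
    rw [sum_filter]; refine sum_congr rfl fun S _ => ?_; split_ifs <;> simp
  have e4 : (∑ S ∈ univ.filter (fun S => S ∩ X ≠ ∅), w S * (u S * v S)) =
      ∑ S, w S * ((if S ∩ X = ∅ then 0 else 1) * (u S * v S)) := by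
    rw [sum_filter]; refine sum_congr rfl fun S _ => ?_
    by_cases h : S ∩ X = ∅ <;> simp [h]
  rw [e1, e2, e3, e4, htot, one_mul] at key
  rw [hR, hU, he, hRU, hRe, hRcUe]
  linarith [key]

end CRClusterLaw

end Summit.Ventures.PercRepro2
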